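import Summits.NavierStokesRegularity.NavierStokesRegularity.Theorems.RecurrentProfilesRecurrentReductionOrbit
import Summits.NavierStokesRegularity.NavierStokesRegularity.Theorems.SqueezeCycleRecurrentLiouvilleGkWindowIncrementRemoval
import Summits.NavierStokesRegularity.NavierStokesRegularity.Theorems.SqueezeCycleRecurrentLiouvilleGkActionTools
import Summits.NavierStokesRegularity.NavierStokesRegularity.Theorems.SqueezeCycleRecurrentLiouvilleGkScalingCurve
import Summits.NavierStokesRegularity.NavierStokesRegularity.Theorems.SqueezeCycleRecurrentLiouvilleGkWeightedTransport
import Summits.NavierStokesRegularity.NavierStokesRegularity.Theorems.SqueezeCycleRecurrentLiouvilleGkIncrementTools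
import Literature.Analysis.FluidPDE.LocalTypeICongr
import Literature.Analysis.FluidPDE.TypeIAncientMild
import HarnessLib

/-!
# Crux `RecurrentLiouville` (stmt-NavierStokesRegularity-1589), line `Sketch` (v6, Giga–Kohn harvest) —
# the harvest: `StationaryWindowRemoval`, `NeverRests`, `OrbitNeverRests`

Theorems-only file (no definitions, no named facts).  The Gaussian SCALING ACTION of a field `u`
(of class `C¹` on the open slab) on a backward window `(a, b) ⊆ (-∞, 0)` is
`∫_{(a,b)×ℝ³} ‖Z u(t,x)‖² K(−t, x) dx dt`, `Z u = ½u + D(uncurry u)(t,x)[(t, x/2)] = ½u + ½(x·∇)u + t∂ₜu`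
the scaling defect (`d/dc|_{c=1} c u(c²t, cx) = 2 Z u`), `K` the heat kernel; it is scale invariant
and vanishes exactly on self-similar windows (strategist census §3 S3 of the crux,
`Cruxes/RecurrentLiouville/HarvestGigaKohnAction.lean`: the Giga–Kohn metric).

* `gk_orbitNeverRests` — increment form, no smoothness: for every `C`, `M < ⊤` there are `R, δ > 0`
  such that at EVERY scale `λ` the normalised scaling orbit of a Type-I singularity model of the
  class moves by `> δ` in `L²((−2,−1)×B_R)` within the factors `1 ≤ c ≤ √2`.
* `gk_stationaryWindowRemoval` — for every rate `C` and bound `M < ⊤` there is `η > 0` such that a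
  suitable weak solution on `ℝ³ × ℝ₋` with weak gradient, `𝐈 ≤ M`, the rate and of class `C¹` on
  the open slab, whose action on SOME unit similarity window `(4t₀, t₀)` is `≤ η`, is regular at
  the origin.
* `gk_neverRests` — the portrait corollary: every Type-I singularity model of the class spends
  action `> η(C, M)` on EVERY unit window ("a Type-I singularity never slows down in similarity
  variables" — false in every solved sibling, where Type-I trajectories have finite action and
  converge to self-similar profiles: the typed specification of what a Navier–Stokes monotonicity
  formula would have to beat).
* `stub_gkHarvest` — registered stub (conjunction of the three).

Inputs (all landed stubs of the line): S1 `stub_gkWindowIncrementRemoval` (compactness + KNSS +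
window Leray/Tsai + forward uniqueness), S2a `stub_gkScalingCurve`, S2b `stub_gkWeightedTransport`,
S3 `stub_gkIncrementTools`, tools `stub_gkActionTools`; and the zoom covariance of the class
(`zoom_slabProfile`, `HasTypeITimeDecay.nsRescale`, `isBackwardSingularPoint_zoom`).  Recurrence is
not used (Disproof §A3); `𝐈 ≤ M` and the equations are (Disproof §A1–A2).

## References

* Y. Giga, R. V. Kohn, Comm. Pure Appl. Math. 38 (1985) 297–319. [GigaKohn1985]
* T.-P. Tsai, Arch. Rational Mech. Anal. 143 (1998), Thm 1. [Tsai1998]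
* D. Albritton, T. Barker, J. Math. Fluid Mech. 21 (2019), Lemma 2.2, Prop. 2.3. [AlbrittonBarker2019]
-/

noncomputable section

-- the sub-problem namespace repeats the summit name (D-0017 layout `Summit.<S>.<P>.Theorems`)
set_option linter.dupNamespace false

namespace Summit.NavierStokesRegularity.NavierStokesRegularity.Theorems

open MeasureTheory Set Function Filter Topology TopologicalSpace Metric
open Literature.Analysis Literature.Analysis.FluidPDE
open scoped NNReal ENNReal

/-! ### The harvest theorems -/

/-- **Orbit never rests** (increment form, no smoothness; from S1 `stub_gkWindowIncrementRemoval`).  For every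
`C` and `M < ⊤` there are `R > 0`, `δ > 0` such that for every Type-I singularity model of the class
(suitable weak on `ℝ³ × ℝ₋`, weak gradient, `𝐈 ≤ M`, rate `C`, singular origin) and EVERY scale
`λ > 0`, the normalised scaling orbit moves: some factor `1 ≤ c ≤ √2` has
`∫_{(−2,−1)×B_R} ‖(u_λ)_c − u_λ‖² > δ`, `u_λ = nsRescale λ u`. [cite: AlbrittonBarker2019, Prop. 2.3] -/
theorem gk_orbitNeverRests :
    ∀ (C : ℝ) (M : ℝ≥0∞), M < ⊤ →
      ∃ R : ℝ, 0 < R ∧ ∃ δ : ℝ, 0 < δ ∧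
        ∀ (u : ℝ → EuclideanSpace ℝ (Fin 3) → EuclideanSpace ℝ (Fin 3))
          (p : ℝ → EuclideanSpace ℝ (Fin 3) → ℝ)
          (G : ℝ → EuclideanSpace ℝ (Fin 3) → EuclideanSpace ℝ (Fin 3) →L[ℝ] EuclideanSpace ℝ (Fin 3)),
          IsSuitableWeakSolutionOn (slab (EuclideanSpace ℝ (Fin 3)) (Iio 0) isOpen_Iio) 1 0 u p →
          HasWeakSpatialGradientOn (slab (EuclideanSpace ℝ (Fin 3)) (Iio 0) isOpen_Iio) u G →
          typeIBound (Iio (0 : ℝ) ×ˢ univ) u p G ≤ M →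
          HasTypeITimeDecay C u →
          IsBackwardSingularPoint u 0 →
          ∀ lam : ℝ, 0 < lam → ∃ c : ℝ, 1 ≤ c ∧ c ^ 2 ≤ 2 ∧
            ENNReal.ofReal δ <
              ∫⁻ z in Ioo (-2 : ℝ) (-1) ×ˢ Metric.ball (0 : EuclideanSpace ℝ (Fin 3)) R,
                ‖nsRescale c (nsRescale lam u) z.1 z.2 - nsRescale lam u z.1 z.2‖ₑ ^ 2 := by
  intro C M hM
  obtain ⟨R, hR, δ, hδ, hrem⟩ := stub_gkWindowIncrementRemoval C M hM
  refine ⟨R, hR, δ, hδ, fun u p G hsw hwg hI hdec hsing lam hlam => ?_⟩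
  by_contra hno
  push Not at hno
  have hz := zoom_slabProfile hsw hwg hlam
  have hdec' : HasTypeITimeDecay C (nsRescale lam u) := hdec.nsRescale hlam
  refine hrem (nsRescale lam u)
    (lam ^ 2 • stPull (lam ^ 2) lam (0 : ℝ) (0 : EuclideanSpace ℝ (Fin 3)) p)
    (lam ^ 2 • stPull (lam ^ 2) lam (0 : ℝ) (0 : EuclideanSpace ℝ (Fin 3)) G) ?_ ?_ ?_ hdec'
    (fun c hc1 hc2 => hno c hc1 hc2) ?_
  · rw [nsRescale_eq_zoom]; exact hz.1
  · rw [nsRescale_eq_zoom]; exact hz.2.1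
  · rw [nsRescale_eq_zoom, hz.2.2]; exact hI
  · rw [nsRescale_eq_zoom]; exact isBackwardSingularPoint_zoom hsing hlam

/-- **Stationary-window removal** (the Giga–Kohn-metric removal theorem, ACTION form; strategist
census §3 S3).  For every rate `C` and bound `M < ⊤`
there is `η > 0` such that a suitable weak solution `(u, p)` on `ℝ³ × ℝ₋` with weak gradient `G`,
`𝐈 ≤ M`, the rate, and of class `C¹` on the open slab, whose Gaussian scaling action
`∫_{(4t₀,t₀)×ℝ³} ‖½u + D(uncurry u)(t,x)[(t, x/2)]‖² K(−t,x)` on SOME unit similarity window is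
`≤ η`, is regular at the space–time origin.  Proof: S2 bounds the weighted orbit increments on
`(2t₀,t₀)` by the action, the Gaussian is bounded below on the box at scale `λ = √(−t₀)`, the
zoom `u_λ` has increments `≤ δ` on `(−2,−1)×B_R` (S3), the class, `𝐈` and the rate are scale
invariant, and S1 removes the singularity. [cite: GigaKohn1985, §2; Tsai1998, Thm 1;
AlbrittonBarker2019, Lemma 2.2, Prop. 2.3] -/
theorem gk_stationaryWindowRemoval :
    ∀ (C : ℝ) (M : ℝ≥0∞), M < ⊤ → ∃ η : ℝ, 0 < η ∧
      ∀ (u : ℝ → EuclideanSpace ℝ (Fin 3) → EuclideanSpace ℝ (Fin 3))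
        (p : ℝ → EuclideanSpace ℝ (Fin 3) → ℝ)
        (G : ℝ → EuclideanSpace ℝ (Fin 3) → EuclideanSpace ℝ (Fin 3) →L[ℝ] EuclideanSpace ℝ (Fin 3)),
        IsSuitableWeakSolutionOn (slab (EuclideanSpace ℝ (Fin 3)) (Iio 0) isOpen_Iio) 1 0 u p →
        HasWeakSpatialGradientOn (slab (EuclideanSpace ℝ (Fin 3)) (Iio 0) isOpen_Iio) u G →
        typeIBound (Iio (0 : ℝ) ×ˢ univ) u p G ≤ M →
        HasTypeITimeDecay C u →
        ContDiffOn ℝ 1 (uncurry u) (Iio (0 : ℝ) ×ˢ univ) →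
        (∃ t₀ : ℝ, t₀ < 0 ∧
          ∫⁻ z in Ioo (4 * t₀) t₀ ×ˢ (univ : Set (EuclideanSpace ℝ (Fin 3))),
            ‖(2 : ℝ)⁻¹ • u z.1 z.2 + fderiv ℝ (uncurry u) z (z.1, (2 : ℝ)⁻¹ • z.2)‖ₑ ^ 2 *
              ENNReal.ofReal (UnboundedOperators.heatKernel (-z.1) z.2) ≤ ENNReal.ofReal η) →
        ¬ IsBackwardSingularPoint u 0 := by
  intro C M hM
  obtain ⟨R, hR, δ, hδ, hrem⟩ := stub_gkWindowIncrementRemoval C M hM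
  set m₀ : ℝ := (8 * Real.pi) ^ (-(3 : ℝ) / 2) * Real.exp (-R ^ 2 / 4) with hm₀
  have hm₀pos : 0 < m₀ := gkSWR_kernel_lower_pos R
  refine ⟨δ * m₀, mul_pos hδ hm₀pos, ?_⟩
  rintro u p G hsw hwg hI hdec hsm ⟨t₀, ht₀, hact⟩ hsing
  -- the scale of the window
  set lam : ℝ := Real.sqrt (-t₀) with hlam
  have hlam0 : 0 < lam := Real.sqrt_pos.2 (neg_pos.2 ht₀)
  have hlam2 : lam ^ 2 = -t₀ := Real.sq_sqrt (neg_pos.2 ht₀).le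
  have hl3 : 0 < lam ^ 3 := pow_pos hlam0 3
  -- the zoom is in the class, with the same `𝐈` and rate, and origin-singular
  have hz := zoom_slabProfile hsw hwg hlam0
  have hdec' : HasTypeITimeDecay C (nsRescale lam u) := hdec.nsRescale hlam0
  have hsing' : IsBackwardSingularPoint (nsRescale lam u) 0 := by
    rw [nsRescale_eq_zoom]; exact isBackwardSingularPoint_zoom hsing hlam0
  refine hrem (nsRescale lam u)
    (lam ^ 2 • stPull (lam ^ 2) lam (0 : ℝ) (0 : EuclideanSpace ℝ (Fin 3)) p)
    (lam ^ 2 • stPull (lam ^ 2) lam (0 : ℝ) (0 : EuclideanSpace ℝ (Fin 3)) G) ?_ ?_ ?_ hdec'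
    (fun c hc1 hc2 => ?_) hsing'
  · rw [nsRescale_eq_zoom]; exact hz.1
  · rw [nsRescale_eq_zoom]; exact hz.2.1
  · rw [nsRescale_eq_zoom, hz.2.2]; exact hI
  -- ## the increments of the zoom on the normalised box are `≤ δ`
  have hc0 : 0 < c := lt_of_lt_of_le one_pos hc1
  -- (S3) zoom covariance
  rw [stub_gkIncrementTools.1 u lam c R hlam0 hc0]
  -- local ≤ weighted at scale `λ`
  have hloc := stub_gkActionTools.2 u c R lam hlam0
  -- weighted ≤ action on the window `(2t₀, t₀)` (S2a + S2b)
  have hw := stub_gkActionTools.1 stub_gkScalingCurve stub_gkWeightedTransport u hsm t₀ ht₀ c hc1 hc2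
  have e2 : -lam ^ 2 = t₀ := by rw [hlam2]; ring
  rw [← hm₀] at hloc
  rw [← e2] at hw hact
  calc ENNReal.ofReal (lam ^ 3)⁻¹ *
        ∫⁻ z in Ioo (-2 * lam ^ 2) (-lam ^ 2) ×ˢ
            Metric.ball (0 : EuclideanSpace ℝ (Fin 3)) (lam * R),
          ‖nsRescale c u z.1 z.2 - u z.1 z.2‖ₑ ^ 2
      ≤ ENNReal.ofReal (lam ^ 3)⁻¹ * (ENNReal.ofReal (lam ^ 3 / m₀) *
          ∫⁻ z in Ioo (2 * (-lam ^ 2)) (-lam ^ 2) ×ˢ (univ : Set (EuclideanSpace ℝ (Fin 3))),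
            ‖nsRescale c u z.1 z.2 - u z.1 z.2‖ₑ ^ 2 *
              ENNReal.ofReal (UnboundedOperators.heatKernel (-z.1) z.2)) := by gcongr
    _ ≤ ENNReal.ofReal (lam ^ 3)⁻¹ * (ENNReal.ofReal (lam ^ 3 / m₀) * ENNReal.ofReal (δ * m₀)) := by
        gcongr
        exact hw.trans hact
    _ = ENNReal.ofReal δ := by
        rw [← ENNReal.ofReal_mul (by positivity), ← ENNReal.ofReal_mul (by positivity)]
        congr 1
        field_simp

/-- **Never rests** (portrait corollary of `gk_stationaryWindowRemoval`).  For every `C`, `M < ⊤` there is `η > 0` such that every Type-I singularity model of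
the class with a `C¹` representative on the open slab spends Gaussian scaling action `> η` on EVERY
unit similarity window `(4t₀, t₀)`, `t₀ < 0`: "a Type-I singularity never slows down in similarity
variables" — the Giga–Kohn-metric dual of `orbit_not_small_of_singular'`, false in every solved
sibling (semilinear heat, harmonic map flow, MCF), and the typed specification of what a
Navier–Stokes monotonicity formula would have to beat. [cite: GigaKohn1985, §2; Tsai1998, Thm 1] -/
theorem gk_neverRests :
    ∀ (C : ℝ) (M : ℝ≥0∞), M < ⊤ → ∃ η : ℝ, 0 < η ∧
      ∀ (u : ℝ → EuclideanSpace ℝ (Fin 3) → EuclideanSpace ℝ (Fin 3))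
        (p : ℝ → EuclideanSpace ℝ (Fin 3) → ℝ)
        (G : ℝ → EuclideanSpace ℝ (Fin 3) → EuclideanSpace ℝ (Fin 3) →L[ℝ] EuclideanSpace ℝ (Fin 3)),
        IsSuitableWeakSolutionOn (slab (EuclideanSpace ℝ (Fin 3)) (Iio 0) isOpen_Iio) 1 0 u p →
        HasWeakSpatialGradientOn (slab (EuclideanSpace ℝ (Fin 3)) (Iio 0) isOpen_Iio) u G →
        typeIBound (Iio (0 : ℝ) ×ˢ univ) u p G ≤ M →
        HasTypeITimeDecay C u →
        ContDiffOn ℝ 1 (uncurry u) (Iio (0 : ℝ) ×ˢ univ) →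
        IsBackwardSingularPoint u 0 →
        ∀ t₀ : ℝ, t₀ < 0 →
          ENNReal.ofReal η <
            ∫⁻ z in Ioo (4 * t₀) t₀ ×ˢ (univ : Set (EuclideanSpace ℝ (Fin 3))),
              ‖(2 : ℝ)⁻¹ • u z.1 z.2 + fderiv ℝ (uncurry u) z (z.1, (2 : ℝ)⁻¹ • z.2)‖ₑ ^ 2 *
                ENNReal.ofReal (UnboundedOperators.heatKernel (-z.1) z.2) := by
  intro C M hM
  obtain ⟨η, hη, H⟩ := gk_stationaryWindowRemoval C M hM
  refine ⟨η, hη, fun u p G hsw hwg hI hdec hsm hsing t₀ ht₀ => ?_⟩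
  by_contra hle
  exact H u p G hsw hwg hI hdec hsm ⟨t₀, ht₀, not_lt.1 hle⟩ hsing


/-- **Never rests, read on the Oseen-mild representative** (the form consumed by portrait files:
no smoothness hypothesis on the class member itself).  For every `C`, `M < ⊤` there is `η > 0` such
that for every Type-I singularity model `(u, p, G)` of the class and every Type-I ancient mild field
`v` with `u = v` a.e. on the slab (such a `v` always exists: `exists_oseenMild_repr_of_typeIBound_lt_top`),
`v` spends Gaussian scaling action `> η` on every unit similarity window `(4t₀, t₀)`.  (The class
predicates, `𝐈` and the singular origin pass to `v` by a.e.-congruence; `v` is smooth on the open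
slab.) [cite: GigaKohn1985, §2; AlbrittonBarker2019, §1] -/
theorem gk_neverRests_repr :
    ∀ (C : ℝ) (M : ℝ≥0∞), M < ⊤ → ∃ η : ℝ, 0 < η ∧
      ∀ (u : ℝ → EuclideanSpace ℝ (Fin 3) → EuclideanSpace ℝ (Fin 3))
        (p : ℝ → EuclideanSpace ℝ (Fin 3) → ℝ)
        (G : ℝ → EuclideanSpace ℝ (Fin 3) → EuclideanSpace ℝ (Fin 3) →L[ℝ] EuclideanSpace ℝ (Fin 3))
        (v : ℝ → EuclideanSpace ℝ (Fin 3) → EuclideanSpace ℝ (Fin 3)),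
        IsSuitableWeakSolutionOn (slab (EuclideanSpace ℝ (Fin 3)) (Iio 0) isOpen_Iio) 1 0 u p →
        HasWeakSpatialGradientOn (slab (EuclideanSpace ℝ (Fin 3)) (Iio 0) isOpen_Iio) u G →
        typeIBound (Iio (0 : ℝ) ×ˢ univ) u p G ≤ M →
        IsBackwardSingularPoint u 0 →
        IsTypeIAncientMild C v →
        (∀ᵐ z ∂(volume.restrict (Iio (0 : ℝ) ×ˢ (univ : Set (EuclideanSpace ℝ (Fin 3))))),
          uncurry u z = uncurry v z) →
        ∀ t₀ : ℝ, t₀ < 0 →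
          ENNReal.ofReal η <
            ∫⁻ z in Ioo (4 * t₀) t₀ ×ˢ (univ : Set (EuclideanSpace ℝ (Fin 3))),
              ‖(2 : ℝ)⁻¹ • v z.1 z.2 + fderiv ℝ (uncurry v) z (z.1, (2 : ℝ)⁻¹ • z.2)‖ₑ ^ 2 *
                ENNReal.ofReal (UnboundedOperators.heatKernel (-z.1) z.2) := by
  intro C M hM
  obtain ⟨η, hη, H⟩ := gk_neverRests C M hM
  refine ⟨η, hη, fun u p G v hsw hwg hI hsing hv hae t₀ ht₀ => ?_⟩
  -- the class predicates, `𝐈` and the singularity pass to the representative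
  have hae' : ∀ᵐ w ∂(volume.restrict ((slab (EuclideanSpace ℝ (Fin 3)) (Iio 0) isOpen_Iio :
      Opens (ℝ × EuclideanSpace ℝ (Fin 3))) : Set (ℝ × EuclideanSpace ℝ (Fin 3)))),
      uncurry u w = uncurry v w := by
    rw [coe_slab]
    exact hae
  have hswv := hsw.congr_ae hae' (ae_of_all _ fun _ => rfl)
  have hwgv := hwg.congr_ae hae'
  have hIv : typeIBound (Iio (0 : ℝ) ×ˢ univ) v p G ≤ M := by
    rwa [← typeIBound_congr_ae hae]
  have hsingv : IsBackwardSingularPoint v 0 :=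
    hsing.congr_ae (fun r _ => parabolicCylinder_origin_subset_slab r) hae
  have hsm : ContDiffOn ℝ 1 (uncurry v) (Iio (0 : ℝ) ×ˢ univ) :=
    hv.contDiffOn.of_le (by exact_mod_cast le_top)
  exact H v p G hswv hwgv hIv hv.hasTypeITimeDecay hsm hsingv t₀ ht₀

/-! ### Registered stub -/

/-- **Registered harvest stub** `stub_gkHarvest` (crux stmt-NavierStokesRegularity-1589, line Sketch
v6): `gk_orbitNeverRests ∧ gk_stationaryWindowRemoval ∧ gk_neverRests`. [cite: GigaKohn1985, §2;
Tsai1998, Thm 1] -/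
theorem stub_gkHarvest :
    (∀ (C : ℝ) (M : ℝ≥0∞), M < ⊤ →
      ∃ R : ℝ, 0 < R ∧ ∃ δ : ℝ, 0 < δ ∧
        ∀ (u : ℝ → EuclideanSpace ℝ (Fin 3) → EuclideanSpace ℝ (Fin 3))
          (p : ℝ → EuclideanSpace ℝ (Fin 3) → ℝ)
          (G : ℝ → EuclideanSpace ℝ (Fin 3) → EuclideanSpace ℝ (Fin 3) →L[ℝ] EuclideanSpace ℝ (Fin 3)),
          IsSuitableWeakSolutionOn (slab (EuclideanSpace ℝ (Fin 3)) (Iio 0) isOpen_Iio) 1 0 u p →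
          HasWeakSpatialGradientOn (slab (EuclideanSpace ℝ (Fin 3)) (Iio 0) isOpen_Iio) u G →
          typeIBound (Iio (0 : ℝ) ×ˢ univ) u p G ≤ M →
          HasTypeITimeDecay C u →
          IsBackwardSingularPoint u 0 →
          ∀ lam : ℝ, 0 < lam → ∃ c : ℝ, 1 ≤ c ∧ c ^ 2 ≤ 2 ∧
            ENNReal.ofReal δ <
              ∫⁻ z in Ioo (-2 : ℝ) (-1) ×ˢ Metric.ball (0 : EuclideanSpace ℝ (Fin 3)) R,
                ‖nsRescale c (nsRescale lam u) z.1 z.2 - nsRescale lam u z.1 z.2‖ₑ ^ 2) ∧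
    (∀ (C : ℝ) (M : ℝ≥0∞), M < ⊤ → ∃ η : ℝ, 0 < η ∧
      ∀ (u : ℝ → EuclideanSpace ℝ (Fin 3) → EuclideanSpace ℝ (Fin 3))
        (p : ℝ → EuclideanSpace ℝ (Fin 3) → ℝ)
        (G : ℝ → EuclideanSpace ℝ (Fin 3) → EuclideanSpace ℝ (Fin 3) →L[ℝ] EuclideanSpace ℝ (Fin 3)),
        IsSuitableWeakSolutionOn (slab (EuclideanSpace ℝ (Fin 3)) (Iio 0) isOpen_Iio) 1 0 u p →
        HasWeakSpatialGradientOn (slab (EuclideanSpace ℝ (Fin 3)) (Iio 0) isOpen_Iio) u G →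
        typeIBound (Iio (0 : ℝ) ×ˢ univ) u p G ≤ M →
        HasTypeITimeDecay C u →
        ContDiffOn ℝ 1 (uncurry u) (Iio (0 : ℝ) ×ˢ univ) →
        (∃ t₀ : ℝ, t₀ < 0 ∧
          ∫⁻ z in Ioo (4 * t₀) t₀ ×ˢ (univ : Set (EuclideanSpace ℝ (Fin 3))),
            ‖(2 : ℝ)⁻¹ • u z.1 z.2 + fderiv ℝ (uncurry u) z (z.1, (2 : ℝ)⁻¹ • z.2)‖ₑ ^ 2 *
              ENNReal.ofReal (UnboundedOperators.heatKernel (-z.1) z.2) ≤ ENNReal.ofReal η) →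
        ¬ IsBackwardSingularPoint u 0) ∧
    (∀ (C : ℝ) (M : ℝ≥0∞), M < ⊤ → ∃ η : ℝ, 0 < η ∧
      ∀ (u : ℝ → EuclideanSpace ℝ (Fin 3) → EuclideanSpace ℝ (Fin 3))
        (p : ℝ → EuclideanSpace ℝ (Fin 3) → ℝ)
        (G : ℝ → EuclideanSpace ℝ (Fin 3) → EuclideanSpace ℝ (Fin 3) →L[ℝ] EuclideanSpace ℝ (Fin 3)),
        IsSuitableWeakSolutionOn (slab (EuclideanSpace ℝ (Fin 3)) (Iio 0) isOpen_Iio) 1 0 u p →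
        HasWeakSpatialGradientOn (slab (EuclideanSpace ℝ (Fin 3)) (Iio 0) isOpen_Iio) u G →
        typeIBound (Iio (0 : ℝ) ×ˢ univ) u p G ≤ M →
        HasTypeITimeDecay C u →
        ContDiffOn ℝ 1 (uncurry u) (Iio (0 : ℝ) ×ˢ univ) →
        IsBackwardSingularPoint u 0 →
        ∀ t₀ : ℝ, t₀ < 0 →
          ENNReal.ofReal η <
            ∫⁻ z in Ioo (4 * t₀) t₀ ×ˢ (univ : Set (EuclideanSpace ℝ (Fin 3))),
              ‖(2 : ℝ)⁻¹ • u z.1 z.2 + fderiv ℝ (uncurry u) z (z.1, (2 : ℝ)⁻¹ • z.2)‖ₑ ^ 2 *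
                ENNReal.ofReal (UnboundedOperators.heatKernel (-z.1) z.2)) :=
  ⟨gk_orbitNeverRests, gk_stationaryWindowRemoval, gk_neverRests⟩

end Summit.NavierStokesRegularity.NavierStokesRegularity.Theorems

end
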